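import Mathlib
import Summits.Ventures.PercRepro2.A3BetweenCondExp

/-!
# Conditioning on the revealed cluster leaves the outside fresh: the domain Markov property of
`C(a₃)` in `condExp` form (blind cell PercRepro2, typer-1 g20; a language line)

`Graph.lean` states the domain Markov property as an identity of events: `{C(v) = S}` is determined
by the edges touching `S` (`dependsOn_clusterEvent`), hence independent of every event of the
other edges (`prob_clusterEvent_inter_eq_mul`).  `A3BetweenCondExp.lean` (g16) identified the
conditional expectation given the revealed cluster `𝒢 = σ(C(a₃))` (`clusterSigma`) with the fibre
mean.  This file gives the conditional-expectation form of the Markov property — the revealed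
cluster is a stopping set, and what lies outside it is an independent copy of the product measure:

* **`expect_indicator_clusterEvent_mul_of_dependsOn`**: `E_p[1_{C = W} · g] = P_p(C = W) · E_p g`
  for `g` determined by the edges not touching `W`;
* **`expect_eq_sum_clusters_of_dependsOn`** / **`prob_eq_sum_clusters_of_dependsOn`** (observables
  and events built from the revealed cluster): if `f W` depends only on the edges not touching `W`,
  then `E_p[ω ↦ f (C ω) ω] = Σ_W P_p(C = W) · E_p (f W)`, and `P_p{ω ∈ A (C ω)} = Σ_W P_p(C = W) · P_p(A W)`;
* **`condExp_clusterSigma_of_dependsOn`** (the Markov property in `condExp` form):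
  `μ_p[ω ↦ f (C ω) ω | σ(C(a₃))] =ᵐ ω ↦ E_p (f (C ω))` for every weight vector.

Identities only; no sign is claimed; the crux and the residual are as they are.
-/

namespace Summit.Ventures.PercRepro2

open UnionCluster MeasureTheory ProbabilityTheory MeasureBridge

namespace CovForm

namespace A3Means

section Fresh

variable {V : Type*} {E : Type*} [Fintype V] [DecidableEq V] [Fintype E] [DecidableEq E]

/-- **Independence of the revealed cluster and the outside**: `E_p[1_{C = W} · g] = P_p(C = W) · E_p g`
for an observable `g` determined by the edges not touching `W`. -/
theorem expect_indicator_clusterEvent_mul_of_dependsOn (p : E → ℝ) (ends : E → Sym2 V) (a₃ : V)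
    (W : Finset V) {g : Config E → ℝ} (hg : DependsOn g (touches ends (↑W : Set V))ᶜ) :
    expect p (fun ω => (clusterEvent ends a₃ (↑W : Set V)).indicator 1 ω * g ω) =
      prob p (clusterEvent ends a₃ (↑W : Set V)) * expect p g := by
  classical
  rw [prob_eq_expect_indicator]
  exact expect_mul_eq_mul_of_dependsOn_compl p (touches ends (↑W : Set V))
    (dependsOn_indicator (dependsOn_clusterEvent ends a₃ (↑W : Set V))) hg

omit [DecidableEq E] in
/-- On the fibre `{C = W}` a cluster-indexed observable reads `f W`. -/
lemma indicator_clusterEvent_mul_eq (ends : E → Sym2 V) (a₃ : V) (W : Finset V)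
    (f : Finset V → Config E → ℝ) :
    (fun ω => (clusterEvent ends a₃ (↑W : Set V)).indicator 1 ω * f (clusterMap ends a₃ ω) ω) =
      fun ω => (clusterEvent ends a₃ (↑W : Set V)).indicator 1 ω * f W ω := by
  funext ω
  by_cases hW : ω ∈ clusterEvent ends a₃ (↑W : Set V)
  · rw [mem_clusterEvent_iff_clusterMap_eq.1 hW]
  · simp [Set.indicator_of_notMem hW]

/-- **Observables built from the revealed cluster**: if `f W` depends only on the edges not
touching `W`, then `E_p[ω ↦ f (C ω) ω] = Σ_W P_p(C = W) · E_p (f W)`. -/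
theorem expect_eq_sum_clusters_of_dependsOn (p : E → ℝ) (ends : E → Sym2 V) (a₃ : V)
    (f : Finset V → Config E → ℝ)
    (hf : ∀ W : Finset V, DependsOn (f W) (touches ends (↑W : Set V))ᶜ) :
    expect p (fun ω => f (clusterMap ends a₃ ω) ω) =
      ∑ W : Finset V, prob p (clusterEvent ends a₃ (↑W : Set V)) * expect p (f W) := by
  rw [expect_eq_sum_clusters p ends a₃]
  refine Finset.sum_congr rfl fun W _ => ?_
  rw [indicator_clusterEvent_mul_eq, expect_indicator_clusterEvent_mul_of_dependsOn p ends a₃ W (hf W)]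

/-- **Events built from the revealed cluster**: if `A W` is an event of the edges not touching
`W`, then `P_p{ω ∈ A (C ω)} = Σ_W P_p(C = W) · P_p(A W)`. -/
theorem prob_eq_sum_clusters_of_dependsOn (p : E → ℝ) (ends : E → Sym2 V) (a₃ : V)
    (A : Finset V → Set (Config E))
    (hA : ∀ W : Finset V, DependsOn (· ∈ A W) (touches ends (↑W : Set V))ᶜ) :
    prob p {ω | ω ∈ A (clusterMap ends a₃ ω)} =
      ∑ W : Finset V, prob p (clusterEvent ends a₃ (↑W : Set V)) * prob p (A W) := by
  rw [prob_eq_expect_indicator]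
  have h : ({ω | ω ∈ A (clusterMap ends a₃ ω)} : Set (Config E)).indicator (1 : Config E → ℝ) =
      fun ω => (A (clusterMap ends a₃ ω)).indicator 1 ω := by
    funext ω
    by_cases hω : ω ∈ A (clusterMap ends a₃ ω)
    · rw [Set.indicator_of_mem hω, Set.indicator_of_mem (show ω ∈ {ω | ω ∈ A (clusterMap ends a₃ ω)}
        from hω)]
    · rw [Set.indicator_of_notMem hω,
        Set.indicator_of_notMem (show ω ∉ {ω | ω ∈ A (clusterMap ends a₃ ω)} from hω)]
  rw [h, expect_eq_sum_clusters_of_dependsOn p ends a₃ (fun W => (A W).indicator 1)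
    (fun W => dependsOn_indicator (hA W))]
  refine Finset.sum_congr rfl fun W _ => ?_
  rw [prob_eq_expect_indicator p (A W)]

end Fresh

section CondExp

variable {V : Type*} {E : Type*} [Fintype V] [DecidableEq V] [Fintype E] [DecidableEq E]

/-- The set integrals of a cluster-indexed observable of the outside over the `𝒢`-measurable sets
`{C ∈ t}` are those of its cluster-wise means. -/
lemma expect_indicator_preimage_cluster_of_dependsOn (p : E → ℝ) (ends : E → Sym2 V) (a₃ : V)
    (f : Finset V → Config E → ℝ)
    (hf : ∀ W : Finset V, DependsOn (f W) (touches ends (↑W : Set V))ᶜ) (t : Set (Finset V)) :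
    expect p ((clusterMap ends a₃ ⁻¹' t).indicator (fun ω => expect p (f (clusterMap ends a₃ ω)))) =
      expect p ((clusterMap ends a₃ ⁻¹' t).indicator (fun ω => f (clusterMap ends a₃ ω) ω)) := by
  classical
  rw [expect_eq_sum_clusters p ends a₃, expect_eq_sum_clusters p ends a₃
    ((clusterMap ends a₃ ⁻¹' t).indicator (fun ω => f (clusterMap ends a₃ ω) ω))]
  refine Finset.sum_congr rfl fun W _ => ?_
  have key : ∀ (h : Config E → ℝ),
      (fun ω => (clusterEvent ends a₃ (↑W : Set V)).indicator 1 ω *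
        (clusterMap ends a₃ ⁻¹' t).indicator h ω) =
      fun ω => (if W ∈ t then (1 : ℝ) else 0) *
        ((clusterEvent ends a₃ (↑W : Set V)).indicator 1 ω * h ω) := by
    intro h
    funext ω
    by_cases hW : ω ∈ clusterEvent ends a₃ (↑W : Set V)
    · have hc : clusterMap ends a₃ ω = W := mem_clusterEvent_iff_clusterMap_eq.1 hW
      by_cases ht : W ∈ t
      · have hpre : ω ∈ clusterMap ends a₃ ⁻¹' t := by rw [Set.mem_preimage, hc]; exact ht
        rw [Set.indicator_of_mem hpre, if_pos ht, one_mul]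
      · have hpre : ω ∉ clusterMap ends a₃ ⁻¹' t := by rw [Set.mem_preimage, hc]; exact ht
        rw [Set.indicator_of_notMem hpre, if_neg ht, zero_mul, mul_zero]
    · simp [Set.indicator_of_notMem hW]
  rw [key, key, expect_const_mul, expect_const_mul]
  congr 1
  rw [indicator_clusterEvent_mul_eq, expect_indicator_clusterEvent_mul_of_dependsOn p ends a₃ W (hf W)]
  have h2 : (fun ω => (clusterEvent ends a₃ (↑W : Set V)).indicator 1 ω *
      expect p (f (clusterMap ends a₃ ω))) =
      fun ω => (clusterEvent ends a₃ (↑W : Set V)).indicator 1 ω * expect p (f W) := by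
    funext ω
    by_cases hW : ω ∈ clusterEvent ends a₃ (↑W : Set V)
    · rw [mem_clusterEvent_iff_clusterMap_eq.1 hW]
    · simp [Set.indicator_of_notMem hW]
  rw [h2]
  have h3 : (fun ω => (clusterEvent ends a₃ (↑W : Set V)).indicator 1 ω * expect p (f W)) =
      fun ω => expect p (f W) * (clusterEvent ends a₃ (↑W : Set V)).indicator 1 ω := by
    funext ω; ring
  rw [h3, expect_const_mul, ← prob_eq_expect_indicator, mul_comm]

/-- **The domain Markov property of the revealed cluster, in `condExp` form**: if `f W` depends
only on the edges not touching `W`, then conditionally on `σ(C(a₃))` the observable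
`ω ↦ f (C ω) ω` has the mean `E_p (f (C ω))` — the outside of the revealed cluster is fresh. -/
theorem condExp_clusterSigma_of_dependsOn (p : E → ℝ) (hp : IsProbVec p) (ends : E → Sym2 V)
    (a₃ : V) (f : Finset V → Config E → ℝ)
    (hf : ∀ W : Finset V, DependsOn (f W) (touches ends (↑W : Set V))ᶜ) :
    (percMeasureOf p hp)[fun ω => f (clusterMap ends a₃ ω) ω | clusterSigma ends a₃]
      =ᵐ[percMeasureOf p hp] fun ω => expect p (f (clusterMap ends a₃ ω)) := by
  refine (ae_eq_condExp_of_forall_setIntegral_eq (clusterSigma_le ends a₃) Integrable.of_finite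
    (fun _ _ _ => Integrable.integrableOn Integrable.of_finite) (fun s hs _ => ?_) ?_).symm
  · obtain ⟨t, -, rfl⟩ := hs
    rw [← integral_indicator MeasurableSet.of_discrete, ← integral_indicator MeasurableSet.of_discrete,
      integral_percMeasureOf, integral_percMeasureOf]
    exact expect_indicator_preimage_cluster_of_dependsOn p ends a₃ f hf t
  · have h1 : @Measurable (Config E) (Finset V) (clusterSigma ends a₃) ⊤ (clusterMap ends a₃) :=
      measurable_iff_comap_le.mpr le_rfl
    have h2 : @Measurable (Finset V) ℝ ⊤ _ (fun W => expect p (f W)) := measurable_from_top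
    exact (h2.comp h1).stronglyMeasurable.aestronglyMeasurable

end CondExp

end A3Means

end CovForm

end Summit.Ventures.PercRepro2
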